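import Literature.Probability.LatticeModels.StrongHarrisKleitman
import Mathlib.Tactic.Linarith
import Mathlib.Tactic.Ring
import Mathlib.Tactic.Positivity
import HarnessLib

/-!
# `NoHeavyLowerTail` (crux stmt-CriticalPhenomena-4575), master-family line P1 (gen 11):
# the Harris–Kleitman defect of an up-set and a down-set dominates the product of any two
# incomparable parts of their intersection

Support file (seat `prim-masterthm-p1`, gen 11; `--supports stmt-CriticalPhenomena-4575`).  No definition,
no `sorry`, standard axioms.  Memo `run/shared/lean/prim/prim-masterthm/FROM-prim-masterthm-p1-g11-ALL-ORDERS.md` §2.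

THEOREM (`prodBernoulli_harris_twoParts`).  Let `μ = prodBernoulli p` be a product measure on `Set ι` (`ι` finite,
or cylinder events over a finite coordinate set `F`), `U` closed upwards, `D` closed downwards, and let
`U ∩ D ⊆ P ∪ Q` with `P, Q ⊆ U ∩ D` disjoint and INCOMPARABLE (no configuration of `P` is contained in or
contains a configuration of `Q`).  Then

  `μ(U ∩ D) + μ(P)·μ(Q) ≤ μ(U)·μ(D)`.

For `Q = ∅` this is the Harris–Kleitman inequality `μ(U ∩ D) ≤ μ(U) μ(D)`; when `U ∪ D` is the whole space it
is Gladkov's Theorem 2.1 with two middle cells (tree `prodBernoulli_strongHarris`, `k = 2`), but in general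
`(U ∪ D)ᶜ` is a sixth region and the statement is STRICTLY stronger than Theorem 2.1 applied to the partition
`(U ∖ D; P, Q; Uᶜ)` (the two differ by `μ(U)·μ((U ∪ D)ᶜ)`).  It is the two-part case of the "all-orders /
convex-set" conjecture `μ(↑M) μ(↓M) ≥ ∏_i (1 + μ(C_i)) − 1` over the comparability components `C_i` of a convex
set `M` (memo §1; exact censuses on ≤ 5 coordinates), whose three-part case contains the co-sunflower class law.

PROOF = Gladkov's coordinate induction (his proof of Thm. 2.1, mirrored from `StrongHarris.core`): split along a
coordinate `e`; the sections `X¹ = insert e ⁻¹' X`, `X⁰ = (· ∖ {e}) ⁻¹' X` form a system of the same kind one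
dimension down; the defect is a quadratic polynomial in `p_e`, nonnegative at `p_e ∈ {0,1}` (induction) and
CONCAVE: writing `μ(P¹) − μ(P⁰) = m_P − ℓ_P` with `m_P = μ(P¹ ∖ P⁰)`, `ℓ_P = μ(P⁰ ∖ P¹)` (and likewise for `Q`),
the key inclusions `P⁰ ∖ P¹, Q⁰ ∖ Q¹ ⊆ D⁰ ∖ D¹` and `P¹ ∖ P⁰, Q¹ ∖ Q⁰ ⊆ U¹ ∖ U⁰` (they use exactly: `U` up, `D` down,
`U ∩ D ⊆ P ∪ Q`, incomparability) give `(μU¹ − μU⁰)(μD⁰ − μD¹) + (m_P − ℓ_P)(m_Q − ℓ_Q) ≥ m_Pℓ_P + m_Qℓ_Q + m_Pm_Q + ℓ_Pℓ_Q ≥ 0`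
(`step_arith`). [this work]
-/

noncomputable section

namespace Summit.CriticalPhenomena.PercolationContinuityZ3.Theorems

namespace HarrisTwoParts

open MeasureTheory Measure Literature.Probability.Percolation Literature.Probability.LatticeModels
  Literature.Probability.LatticeModels.StrongHarris
open scoped ENNReal

variable {ι : Type*}

/-! ### The arithmetic of the induction step -/

/-- **Induction step, as real arithmetic.**  With `u₀ + m_P + m_Q ≤ u₁`, `d₁ + ℓ_P + ℓ_Q ≤ d₀`, the two induction
hypotheses `n_s + a_s b_s ≤ u_s d_s` (`a₁ = w + m_P`, `a₀ = w + ℓ_P`, `b₁ = w' + m_Q`, `b₀ = w' + ℓ_Q`) and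
`p ∈ [0,1]`, the convex combination satisfies `n + a b ≤ u d`: the defect is a concave quadratic in `p`.
[this work] -/
theorem step_arith {p u₀ u₁ d₀ d₁ n₀ n₁ w mP lP w' mQ lQ : ℝ} (hp0 : 0 ≤ p) (hp1 : p ≤ 1)
    (hmP : 0 ≤ mP) (hlP : 0 ≤ lP) (hmQ : 0 ≤ mQ) (hlQ : 0 ≤ lQ)
    (hu : u₀ + mP + mQ ≤ u₁) (hd : d₁ + lP + lQ ≤ d₀)
    (ih₁ : n₁ + (w + mP) * (w' + mQ) ≤ u₁ * d₁) (ih₀ : n₀ + (w + lP) * (w' + lQ) ≤ u₀ * d₀) :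
    (p * n₁ + (1 - p) * n₀) + (p * (w + mP) + (1 - p) * (w + lP)) * (p * (w' + mQ) + (1 - p) * (w' + lQ)) ≤
      (p * u₁ + (1 - p) * u₀) * (p * d₁ + (1 - p) * d₀) := by
  have h1 : (mP + mQ) * (lP + lQ) ≤ (u₁ - u₀) * (d₀ - d₁) :=
    mul_le_mul (by linarith) (by linarith) (by positivity) (by linarith)
  set G := (u₁ - u₀) * (d₀ - d₁) + (mP - lP) * (mQ - lQ) with hG
  have hG0 : 0 ≤ G := by
    have e : (mP + mQ) * (lP + lQ) + (mP - lP) * (mQ - lQ) = mP * lP + mQ * lQ + mP * mQ + lP * lQ := by ring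
    nlinarith [mul_nonneg hmP hlP, mul_nonneg hmQ hlQ, mul_nonneg hmP hmQ, mul_nonneg hlP hlQ]
  have key : (p * u₁ + (1 - p) * u₀) * (p * d₁ + (1 - p) * d₀) -
      ((p * n₁ + (1 - p) * n₀) + (p * (w + mP) + (1 - p) * (w + lP)) * (p * (w' + mQ) + (1 - p) * (w' + lQ))) =
      p * (u₁ * d₁ - (n₁ + (w + mP) * (w' + mQ))) + (1 - p) * (u₀ * d₀ - (n₀ + (w + lP) * (w' + lQ))) +
        p * (1 - p) * G := by
    rw [hG]; ring
  have h7 : 0 ≤ p * (u₁ * d₁ - (n₁ + (w + mP) * (w' + mQ))) := mul_nonneg hp0 (by linarith)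
  have h8 : 0 ≤ (1 - p) * (u₀ * d₀ - (n₀ + (w + lP) * (w' + lQ))) := mul_nonneg (by linarith) (by linarith)
  have h9 : 0 ≤ p * (1 - p) * G := mul_nonneg (mul_nonneg hp0 (by linarith)) hG0
  linarith [key, h7, h8, h9]

/-! ### The induction on the set of coordinates -/

/-- **The core statement**, by induction on the finite coordinate set `F`: for cylinder events `U` (up), `D` (down),
`P, Q ⊆ U ∩ D` disjoint, incomparable, covering `U ∩ D`: `μ(U ∩ D) + μ(P) μ(Q) ≤ μ(U) μ(D)`. [this work] -/
theorem core [DecidableEq ι] (p : ι → unitInterval) (F : Finset ι) :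
    ∀ (U D P Q : Set (Set ι)), IsUpperSet U → IsLowerSet D →
      P ⊆ U ∩ D → Q ⊆ U ∩ D → Disjoint P Q → U ∩ D ⊆ P ∪ Q →
      (∀ ω ∈ P, ∀ ω' ∈ Q, ¬ ω ⊆ ω' ∧ ¬ ω' ⊆ ω) →
      DeterminedBy U (↑F : Set ι) → DeterminedBy D (↑F : Set ι) →
      DeterminedBy P (↑F : Set ι) → DeterminedBy Q (↑F : Set ι) →
      (prodBernoulli p).real (U ∩ D) + (prodBernoulli p).real P * (prodBernoulli p).real Q ≤
        (prodBernoulli p).real U * (prodBernoulli p).real D := by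
  set μ := prodBernoulli p with hμ
  induction F using Finset.induction_on with
  | empty =>
    intro U D P Q hU hD hP hQ hPQ hcov hinc dU dD dP dQ
    have triv : ∀ X : Set (Set ι), DeterminedBy X (↑(∅ : Finset ι) : Set ι) →
        μ.real X = 0 ∨ μ.real X = 1 := by
      intro X hX
      rw [determinedBy_iff] at hX
      by_cases hne : X.Nonempty
      · obtain ⟨ω₀, hω₀⟩ := hne
        have : X = Set.univ := Set.eq_univ_of_forall fun ω => (hX ω ω₀ (by simp)).2 hω₀
        exact Or.inr (by rw [this, probReal_univ])
      · exact Or.inl (by rw [Set.not_nonempty_iff_eq_empty.1 hne, measureReal_empty])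
    have mP : MeasurableSet P := dP.measurableSet_of_finset
    have mQ : MeasurableSet Q := dQ.measurableSet_of_finset
    have hmU : μ.real (U ∩ D) ≤ μ.real U := measureReal_mono Set.inter_subset_left (measure_ne_top _ _)
    have hmD : μ.real (U ∩ D) ≤ μ.real D := measureReal_mono Set.inter_subset_right (measure_ne_top _ _)
    have hab : μ.real P + μ.real Q ≤ μ.real (U ∩ D) := by
      rw [← measureReal_union hPQ mQ (measure_ne_top _ _) (measure_ne_top _ _)]
      exact measureReal_mono (Set.union_subset hP hQ) (measure_ne_top _ _)
    have ha0 : 0 ≤ μ.real P := measureReal_nonneg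
    have hb0 : 0 ≤ μ.real Q := measureReal_nonneg
    have hm0 : 0 ≤ μ.real (U ∩ D) := measureReal_nonneg
    have hy0 : 0 ≤ μ.real D := measureReal_nonneg
    rcases triv U dU with hx | hx
    · -- `μ U = 0`: everything on the left vanishes
      have hm : μ.real (U ∩ D) = 0 := le_antisymm (by linarith) hm0
      have ha : μ.real P = 0 := le_antisymm (by linarith) ha0
      rw [hm, ha, hx]; simp
    · rcases triv P dP with ha | ha
      · rw [ha, hx]; linarith
      · have hb : μ.real Q = 0 := le_antisymm (by linarith) hb0
        rw [hb, hx]; linarith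
  | insert e F' he ih =>
    intro U D P Q hU hD hP hQ hPQ hcov hinc dU dD dP dQ
    -- the sections
    set U₁ := insert e ⁻¹' U with hU₁d
    set U₀ := (· \ {e}) ⁻¹' U with hU₀d
    set D₁ := insert e ⁻¹' D with hD₁d
    set D₀ := (· \ {e}) ⁻¹' D with hD₀d
    set P₁ := insert e ⁻¹' P with hP₁d
    set P₀ := (· \ {e}) ⁻¹' P with hP₀d
    set Q₁ := insert e ⁻¹' Q with hQ₁d
    set Q₀ := (· \ {e}) ⁻¹' Q with hQ₀d
    have hle : ∀ ω : Set ι, ω \ {e} ⊆ insert e ω := fun ω =>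
      (Set.sdiff_subset).trans (Set.subset_insert e ω)
    have mono_ins : ∀ ω ω' : Set ι, ω ⊆ ω' → insert e ω ⊆ insert e ω' := fun ω ω' h =>
      Set.insert_subset_insert h
    have mono_del : ∀ ω ω' : Set ι, ω ⊆ ω' → ω \ {e} ⊆ ω' \ {e} := fun ω ω' h x hx =>
      ⟨h hx.1, hx.2⟩
    -- determinacy of the sections
    have dU₁ : DeterminedBy U₁ (↑F' : Set ι) := determinedBy_preimage_insert dU
    have dU₀ : DeterminedBy U₀ (↑F' : Set ι) := determinedBy_preimage_sdiff dU
    have dD₁ : DeterminedBy D₁ (↑F' : Set ι) := determinedBy_preimage_insert dD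
    have dD₀ : DeterminedBy D₀ (↑F' : Set ι) := determinedBy_preimage_sdiff dD
    have dP₁ : DeterminedBy P₁ (↑F' : Set ι) := determinedBy_preimage_insert dP
    have dP₀ : DeterminedBy P₀ (↑F' : Set ι) := determinedBy_preimage_sdiff dP
    have dQ₁ : DeterminedBy Q₁ (↑F' : Set ι) := determinedBy_preimage_insert dQ
    have dQ₀ : DeterminedBy Q₀ (↑F' : Set ι) := determinedBy_preimage_sdiff dQ
    have mU₁ : MeasurableSet U₁ := dU₁.measurableSet_of_finset
    have mU₀ : MeasurableSet U₀ := dU₀.measurableSet_of_finset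
    have mD₁ : MeasurableSet D₁ := dD₁.measurableSet_of_finset
    have mD₀ : MeasurableSet D₀ := dD₀.measurableSet_of_finset
    have mP₁ : MeasurableSet P₁ := dP₁.measurableSet_of_finset
    have mP₀ : MeasurableSet P₀ := dP₀.measurableSet_of_finset
    have mQ₁ : MeasurableSet Q₁ := dQ₁.measurableSet_of_finset
    have mQ₀ : MeasurableSet Q₀ := dQ₀.measurableSet_of_finset
    -- order structure of the sections
    have hU₁up : IsUpperSet U₁ := isUpperSet_preimage_insert hU
    have hU₀up : IsUpperSet U₀ := isUpperSet_preimage_sdiff hU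
    have hD₁lo : IsLowerSet D₁ := fun ω ω' h hω => hD (mono_ins ω' ω h) hω
    have hD₀lo : IsLowerSet D₀ := fun ω ω' h hω => hD (mono_del ω' ω h) hω
    -- induction hypotheses for the two section systems
    have ih₁ := ih U₁ D₁ P₁ Q₁ hU₁up hD₁lo (fun ω h => hP h) (fun ω h => hQ h) (hPQ.preimage _)
      (fun ω h => hcov h)
      (fun ω hω ω' hω' => ⟨fun h => (hinc _ hω _ hω').1 (mono_ins ω ω' h),
        fun h => (hinc _ hω _ hω').2 (mono_ins ω' ω h)⟩) dU₁ dD₁ dP₁ dQ₁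
    have ih₀ := ih U₀ D₀ P₀ Q₀ hU₀up hD₀lo (fun ω h => hP h) (fun ω h => hQ h) (hPQ.preimage _)
      (fun ω h => hcov h)
      (fun ω hω ω' hω' => ⟨fun h => (hinc _ hω _ hω').1 (mono_del ω ω' h),
        fun h => (hinc _ hω _ hω').2 (mono_del ω' ω h)⟩) dU₀ dD₀ dP₀ dQ₀
    -- nesting of the sections of `U` and `D`
    have hU₀₁ : U₀ ⊆ U₁ := fun ω hω => hU (hle ω) hω
    have hD₁₀ : D₁ ⊆ D₀ := fun ω hω => hD (hle ω) hω
    -- the four key inclusions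
    have kP₀ : P₀ \ P₁ ⊆ D₀ \ D₁ := by
      intro ω hω
      refine ⟨(hP hω.1).2, fun hD₁' => ?_⟩
      have hU₁' : insert e ω ∈ U := hU (hle ω) (hP hω.1).1
      rcases hcov ⟨hU₁', hD₁'⟩ with h | h
      · exact hω.2 h
      · exact (hinc _ hω.1 _ h).1 (hle ω)
    have kQ₀ : Q₀ \ Q₁ ⊆ D₀ \ D₁ := by
      intro ω hω
      refine ⟨(hQ hω.1).2, fun hD₁' => ?_⟩
      have hU₁' : insert e ω ∈ U := hU (hle ω) (hQ hω.1).1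
      rcases hcov ⟨hU₁', hD₁'⟩ with h | h
      · exact (hinc _ h _ hω.1).2 (hle ω)
      · exact hω.2 h
    have kP₁ : P₁ \ P₀ ⊆ U₁ \ U₀ := by
      intro ω hω
      refine ⟨(hP hω.1).1, fun hU₀' => ?_⟩
      have hD₀' : ω \ {e} ∈ D := hD (hle ω) (hP hω.1).2
      rcases hcov ⟨hU₀', hD₀'⟩ with h | h
      · exact hω.2 h
      · exact (hinc _ hω.1 _ h).2 (hle ω)
    have kQ₁ : Q₁ \ Q₀ ⊆ U₁ \ U₀ := by
      intro ω hω
      refine ⟨(hQ hω.1).1, fun hU₀' => ?_⟩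
      have hD₀' : ω \ {e} ∈ D := hD (hle ω) (hQ hω.1).2
      rcases hcov ⟨hU₀', hD₀'⟩ with h | h
      · exact (hinc _ h _ hω.1).1 (hle ω)
      · exact hω.2 h
    have hPQ₀ : Disjoint P₀ Q₀ := hPQ.preimage _
    have hPQ₁ : Disjoint P₁ Q₁ := hPQ.preimage _
    -- `μ(D¹) + μ(P⁰ ∖ P¹) + μ(Q⁰ ∖ Q¹) ≤ μ(D⁰)`
    have hd : μ.real D₁ + μ.real (P₀ \ P₁) + μ.real (Q₀ \ Q₁) ≤ μ.real D₀ := by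
      have d1 : Disjoint D₁ (P₀ \ P₁) := Set.disjoint_left.2 fun ω h1 h2 => (kP₀ h2).2 h1
      have d2 : Disjoint (D₁ ∪ (P₀ \ P₁)) (Q₀ \ Q₁) := by
        refine Set.disjoint_left.2 fun ω h1 h2 => ?_
        rcases h1 with h1 | h1
        · exact (kQ₀ h2).2 h1
        · exact Set.disjoint_left.1 hPQ₀ h1.1 h2.1
      have hsub : D₁ ∪ (P₀ \ P₁) ∪ (Q₀ \ Q₁) ⊆ D₀ :=
        Set.union_subset (Set.union_subset hD₁₀ fun ω h => (kP₀ h).1) fun ω h => (kQ₀ h).1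
      calc μ.real D₁ + μ.real (P₀ \ P₁) + μ.real (Q₀ \ Q₁)
          = μ.real (D₁ ∪ (P₀ \ P₁) ∪ (Q₀ \ Q₁)) := by
            rw [measureReal_union d2 (mQ₀.diff mQ₁) (measure_ne_top _ _) (measure_ne_top _ _),
              measureReal_union d1 (mP₀.diff mP₁) (measure_ne_top _ _) (measure_ne_top _ _)]
        _ ≤ μ.real D₀ := measureReal_mono hsub (measure_ne_top _ _)
    -- `μ(U⁰) + μ(P¹ ∖ P⁰) + μ(Q¹ ∖ Q⁰) ≤ μ(U¹)`
    have hu : μ.real U₀ + μ.real (P₁ \ P₀) + μ.real (Q₁ \ Q₀) ≤ μ.real U₁ := by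
      have d1 : Disjoint U₀ (P₁ \ P₀) := Set.disjoint_left.2 fun ω h1 h2 => (kP₁ h2).2 h1
      have d2 : Disjoint (U₀ ∪ (P₁ \ P₀)) (Q₁ \ Q₀) := by
        refine Set.disjoint_left.2 fun ω h1 h2 => ?_
        rcases h1 with h1 | h1
        · exact (kQ₁ h2).2 h1
        · exact Set.disjoint_left.1 hPQ₁ h1.1 h2.1
      have hsub : U₀ ∪ (P₁ \ P₀) ∪ (Q₁ \ Q₀) ⊆ U₁ :=
        Set.union_subset (Set.union_subset hU₀₁ fun ω h => (kP₁ h).1) fun ω h => (kQ₁ h).1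
      calc μ.real U₀ + μ.real (P₁ \ P₀) + μ.real (Q₁ \ Q₀)
          = μ.real (U₀ ∪ (P₁ \ P₀) ∪ (Q₁ \ Q₀)) := by
            rw [measureReal_union d2 (mQ₁.diff mQ₀) (measure_ne_top _ _) (measure_ne_top _ _),
              measureReal_union d1 (mP₁.diff mP₀) (measure_ne_top _ _) (measure_ne_top _ _)]
        _ ≤ μ.real U₁ := measureReal_mono hsub (measure_ne_top _ _)
    -- masses of the sections of `P` and `Q`: common part plus the two differences
    have split : ∀ (X Y : Set (Set ι)), MeasurableSet X → MeasurableSet Y →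
        μ.real X = μ.real (X ∩ Y) + μ.real (X \ Y) := by
      intro X Y mX mY
      have hd' : Disjoint (X ∩ Y) (X \ Y) := Set.disjoint_left.2 fun ω h1 h2 => h2.2 h1.2
      have hset : X ∩ Y ∪ X \ Y = X := by
        ext ω; constructor
        · rintro (h | h)
          · exact h.1
          · exact h.1
        · intro h
          by_cases hY : ω ∈ Y
          · exact Or.inl ⟨h, hY⟩
          · exact Or.inr ⟨h, hY⟩
      rw [← measureReal_union hd' (mX.diff mY) (measure_ne_top _ _) (measure_ne_top _ _), hset]
    have eP₁ : μ.real P₁ = μ.real (P₁ ∩ P₀) + μ.real (P₁ \ P₀) := split P₁ P₀ mP₁ mP₀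
    have eP₀ : μ.real P₀ = μ.real (P₁ ∩ P₀) + μ.real (P₀ \ P₁) := by
      rw [Set.inter_comm]; exact split P₀ P₁ mP₀ mP₁
    have eQ₁ : μ.real Q₁ = μ.real (Q₁ ∩ Q₀) + μ.real (Q₁ \ Q₀) := split Q₁ Q₀ mQ₁ mQ₀
    have eQ₀ : μ.real Q₀ = μ.real (Q₁ ∩ Q₀) + μ.real (Q₀ \ Q₁) := by
      rw [Set.inter_comm]; exact split Q₀ Q₁ mQ₀ mQ₁
    -- one-coordinate decompositions
    have decU := real_eq_preimage_insert_add_preimage_sdiff p e dU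
    have decD := real_eq_preimage_insert_add_preimage_sdiff p e dD
    have decP := real_eq_preimage_insert_add_preimage_sdiff p e dP
    have decQ := real_eq_preimage_insert_add_preimage_sdiff p e dQ
    have decM := real_eq_preimage_insert_add_preimage_sdiff p e (dU.inter dD)
    have eM₁ : insert e ⁻¹' (U ∩ D) = U₁ ∩ D₁ := rfl
    have eM₀ : (· \ {e}) ⁻¹' (U ∩ D) = U₀ ∩ D₀ := rfl
    rw [eM₁, eM₀] at decM
    rw [hμ, decM, decP, decQ, decU, decD, ← hμ, eP₁, eP₀, eQ₁, eQ₀]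
    rw [eP₁, eQ₁] at ih₁
    rw [eP₀, eQ₀] at ih₀
    have hu' : μ.real U₀ + μ.real (P₁ \ P₀) + μ.real (Q₁ \ Q₀) ≤ μ.real U₁ := hu
    exact step_arith (p e).2.1 (p e).2.2 measureReal_nonneg measureReal_nonneg measureReal_nonneg
      measureReal_nonneg hu' hd ih₁ ih₀

/-- **THEOREM (Harris–Kleitman defect vs. two incomparable parts; cylinder-event form).**  For
`μ = prodBernoulli p` on `Set ι`, an up-set `U` and a down-set `D` determined by a finite coordinate set `F`, and
disjoint, incomparable `P, Q ⊆ U ∩ D` with `U ∩ D ⊆ P ∪ Q` (also determined by `F`):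
`μ(U ∩ D) + μ(P) μ(Q) ≤ μ(U) μ(D)`. [this work] -/
theorem prodBernoulli_harris_twoParts_of_determinedBy (p : ι → unitInterval) (F : Finset ι)
    {U D P Q : Set (Set ι)} (hU : IsUpperSet U) (hD : IsLowerSet D)
    (hP : P ⊆ U ∩ D) (hQ : Q ⊆ U ∩ D) (hPQ : Disjoint P Q) (hcov : U ∩ D ⊆ P ∪ Q)
    (hinc : ∀ ω ∈ P, ∀ ω' ∈ Q, ¬ ω ⊆ ω' ∧ ¬ ω' ⊆ ω)
    (dU : DeterminedBy U (↑F : Set ι)) (dD : DeterminedBy D (↑F : Set ι))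
    (dP : DeterminedBy P (↑F : Set ι)) (dQ : DeterminedBy Q (↑F : Set ι)) :
    (prodBernoulli p).real (U ∩ D) + (prodBernoulli p).real P * (prodBernoulli p).real Q ≤
      (prodBernoulli p).real U * (prodBernoulli p).real D := by
  classical
  exact core p F U D P Q hU hD hP hQ hPQ hcov hinc dU dD dP dQ

/-- **THEOREM (Harris–Kleitman defect vs. two incomparable parts; finite index type).**  For
`μ = prodBernoulli p` on `Set ι`, `ι` finite: if `U` is closed upwards, `D` closed downwards, and `U ∩ D` is
covered by two disjoint, mutually incomparable sets `P, Q ⊆ U ∩ D`, then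
`μ(U ∩ D) + μ(P)·μ(Q) ≤ μ(U)·μ(D)`.  (`Q = ∅`: Harris–Kleitman; `U ∪ D = univ`: Gladkov's Thm. 2.1, `k = 2`.)
[this work] -/
theorem prodBernoulli_harris_twoParts [Finite ι] (p : ι → unitInterval) {U D P Q : Set (Set ι)}
    (hU : IsUpperSet U) (hD : IsLowerSet D) (hP : P ⊆ U ∩ D) (hQ : Q ⊆ U ∩ D) (hPQ : Disjoint P Q)
    (hcov : U ∩ D ⊆ P ∪ Q) (hinc : ∀ ω ∈ P, ∀ ω' ∈ Q, ¬ ω ⊆ ω' ∧ ¬ ω' ⊆ ω) :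
    (prodBernoulli p).real (U ∩ D) + (prodBernoulli p).real P * (prodBernoulli p).real Q ≤
      (prodBernoulli p).real U * (prodBernoulli p).real D := by
  classical
  haveI := Fintype.ofFinite ι
  have hall : ∀ X : Set (Set ι), DeterminedBy X (↑(Finset.univ : Finset ι) : Set ι) := fun X => by
    rw [determinedBy_iff]; intro ω ω' h; simp only [Finset.coe_univ, Set.inter_univ] at h; rw [h]
  exact prodBernoulli_harris_twoParts_of_determinedBy p Finset.univ hU hD hP hQ hPQ hcov hinc (hall U)
    (hall D) (hall P) (hall Q)

/-- **Convex-set form.**  For `ι` finite, a set `M` of configurations which is an intersection of an up-set and a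
down-set (`M = U ∩ D`), split into two disjoint, mutually incomparable parts `M = P ∪ Q`:
`μ(M) + μ(P) μ(Q) ≤ μ(U) μ(D)` for every up-set `U` and down-set `D` with `U ∩ D = M` — in particular for the
smallest ones, the upper and lower closures of `M`. [this work] -/
theorem prodBernoulli_convex_twoParts [Finite ι] (p : ι → unitInterval) {U D P Q : Set (Set ι)}
    (hU : IsUpperSet U) (hD : IsLowerSet D) (hM : U ∩ D = P ∪ Q) (hPQ : Disjoint P Q)
    (hinc : ∀ ω ∈ P, ∀ ω' ∈ Q, ¬ ω ⊆ ω' ∧ ¬ ω' ⊆ ω) :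
    (prodBernoulli p).real (P ∪ Q) + (prodBernoulli p).real P * (prodBernoulli p).real Q ≤
      (prodBernoulli p).real U * (prodBernoulli p).real D := by
  rw [← hM]
  exact prodBernoulli_harris_twoParts p hU hD (hM ▸ Set.subset_union_left) (hM ▸ Set.subset_union_right)
    hPQ hM.le hinc

/-- **Sanity corollary: the Harris–Kleitman inequality** for an up-set and a down-set (`Q = ∅`, `P = U ∩ D`):
`μ(U ∩ D) ≤ μ(U) μ(D)`. [folklore] -/
theorem prodBernoulli_harrisKleitman_of_twoParts [Finite ι] (p : ι → unitInterval) {U D : Set (Set ι)}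
    (hU : IsUpperSet U) (hD : IsLowerSet D) :
    (prodBernoulli p).real (U ∩ D) ≤ (prodBernoulli p).real U * (prodBernoulli p).real D := by
  have h := prodBernoulli_harris_twoParts p (P := U ∩ D) (Q := ∅) hU hD le_rfl (Set.empty_subset _)
    (Set.disjoint_empty _) (by simp) (fun ω _ ω' hω' => absurd hω' (Set.notMem_empty _))
  simpa using h

end HarrisTwoParts

end Summit.CriticalPhenomena.PercolationContinuityZ3.Theorems
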